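import Literature.NumberTheory.Automorphic.Liu2021.LemD1DataOfPlace
import Literature.NumberTheory.Automorphic.Liu2021.LemD1AsPrintedTwist
import Literature.NumberTheory.Automorphic.Liu2021.Def411WeilCarriersSurvivalNonsplit
import Literature.NumberTheory.GelbartRogawski1991.LocalSplittingsDifferByCharacter
import HarnessLib

/-!
# [Liu2021, App. D Lem. D.1 (1)] at a finite place: the reading does not depend on the normalisation of the
# local splitting (junction form; at a non-split place, for every Step-3 character)

Topic `NumberTheory/Automorphic/Liu2021`; namespace `Literature.NumberTheory.Automorphic.Liu2021.LemD1OfPlace` (that of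
`LemD1DataOfPlace.lean`).  KERNEL ONLY: theorems; no definition, no record, no named fact, no `sorry`.  Nothing of
[Liu2021] is asserted.

`LemD1DataOfPlace.lean` builds [Liu2021, App. D §D.1]'s datum `LemD1OfPlace.data … J₁ ω μ … χ …` at a finite place `v`
of the quadratic extension `E/F` on a GIVEN representation `ω` of `U(J)(F_v) = UnitaryGroup.localPi E c N J v` (read on
the standing data's `U(V)(F_v)` along `uEquiv`) and a character `χ` of the local centre `U(J₁)(F_v) = E_v¹` (read on
`S.normOne` along `theta`).  The consumers take `ω := 𝓢.omegaLoc v`, the local Weil representation of ONE family `𝓢` of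
local splittings (`Def411WeilCarriers.localLemD1Data`, the per-place cite `hD1` of the Hodge/COR-CM END display).
Two such families give `𝓢'.omegaLoc v = η_v • 𝓢.omegaLoc v` for a character `η_v` of `U(J)(F_v)` with OPEN kernel
(`GelbartRogawski1991/LocalSplittingsDifferByCharacter.lean`, the local form of [GelbartRogawski1991, §3.1 Remark
p. 457]), and the as-printed record `LemD1_1AsPrinted` is invariant under such twists at rank `≠ 2`
(`Liu2021/LemD1AsPrintedTwist.lean`).  This file joins the two at the junction:

* §1 `data_twist_eq` — twisting the junction datum by `η ∘ uEquiv` IS the junction datum of the twisted representation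
  `η • ω` with Step-3 character `χ · (η ∘ localCenter)` (the two centres agree, `localCenter_theta`); with the
  bookkeeping `continuous_eta_localCenter` (open kernel ⇒ continuous on the centre), `norm_mul_eta_localCenter`,
  `continuous_mul_eta_localCenter`, `norm_eta_uEquiv_scalar`, `continuous_eta_uEquiv_scalar`;
* §2 `lemD1_1AsPrinted_data_twist_iff` — for `N ≠ 2`, an open-kernel `η` UNITARY on the centre:
  `LemD1_1AsPrinted (data (η • ω) μ (χ · η∘centre)) ↔ LemD1_1AsPrinted (data ω μ χ)`; hence
  `forall_lemD1_1AsPrinted_of_twist`: the family of readings over ALL unitary continuous `χ` passes from `ω` to `η • ω`;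
* §3 at a NON-SPLIT place (`c • w = w` for the place `w ∣ v`; then `U(J₁)(F_v) = E_v¹` is compact,
  `compactSpace_localPi_one_of_smul_eq`, so every open-kernel character is unitary on it, `norm_eta_localCenter_eq_one`):
  **`forall_lemD1_1AsPrinted_iff_of_nonsplit`** — for two families `𝓢, 𝓢'` of local splittings and `N ≠ 2`,
  `(∀ χ, LemD1_1AsPrinted (data (𝓢.omegaLoc v) μ χ)) ↔ (∀ χ, LemD1_1AsPrinted (data (𝓢'.omegaLoc v) μ χ))`
  (`χ` over the unitary continuous characters of `U(J₁)(F_v)`): AT A NON-SPLIT PLACE THE READING OF LEMMA D.1 (1) FOR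
  ALL STEP-3 CHARACTERS DOES NOT DEPEND ON THE CHOICE OF LOCAL SPLITTINGS.  (At a split place `E_v¹ ≅ F_vˣ` is not
  compact and unitarity of `η_v` on the centre is a genuine condition; §2 applies there under that hypothesis.)

## References
* [Liu2021] Y. Liu, Camb. J. Math. 9 (2021) = arXiv:2102.11518, App. D §D.1 Steps 1–3 (l. 5215–5222), Lem. D.1
  (l. 5226–5229).
* [GelbartRogawski1991] S. Gelbart, J. Rogawski, Invent. Math. 105 (1991), §3.1 Remark p. 457 L4–13.
* [PlatonovRapinchuk1994] V. Platonov, A. Rapinchuk, *Algebraic groups and number theory* (1994), §6.2 (the norm-one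
  torus at a non-split place is compact).
* [BernsteinZelevinsky1976] I. N. Bernstein, A. V. Zelevinsky, Russian Math. Surveys 31 (1976), §2.1.
-/

set_option autoImplicit false

noncomputable section

open scoped Matrix
open NumberField IsDedekindDomain Filter
open Literature.RepresentationTheory (SeesawScalar.twist SeesawScalar.twist_apply SeesawScalar.twist_twist
  SeesawScalar.twist_one)
open Literature.RepresentationTheory.Liu2021 (OscillatorStandingData)
open Literature.NumberTheory.GelbartRogawski1991.UnitaryDualPair.LocalSplitting (FinLocalSplittings)

namespace Literature.NumberTheory.Automorphic.Liu2021.LemD1OfPlace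

open UnitaryGroup

/-! ## §0 Two private facts on characters of topological groups -/

/-- a homomorphism into `ℂˣ` with open kernel is continuous (it is locally constant; continuity at `1` suffices on a
topological group). [folklore] -/
private theorem continuous_coe_of_isOpen_ker {G : Type*} [Group G] [TopologicalSpace G] [IsTopologicalGroup G]
    (f : G →* ℂˣ) (hf : IsOpen ((f.ker : Subgroup G) : Set G)) : Continuous fun g => ((f g : ℂˣ) : ℂ) := by
  have hc : Continuous f :=
    continuous_of_continuousAt_one f
      ((continuousAt_const : ContinuousAt (fun _ : G => (1 : ℂˣ)) 1).congr_of_eventuallyEq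
        (Filter.eventually_of_mem (hf.mem_nhds (one_mem _)) fun z hz => (MonoidHom.mem_ker).1 hz))
  exact Units.continuous_val.comp hc

/-- a continuous homomorphism from a compact group into `ℂˣ` takes values of norm `1` (its norm is a bounded
multiplicative function, so `≤ 1`, and the same for the inverse). [folklore] -/
private theorem norm_coe_eq_one_of_compactSpace {G : Type*} [Group G] [TopologicalSpace G] [CompactSpace G]
    (f : G →* ℂˣ) (hf : Continuous fun g => ((f g : ℂˣ) : ℂ)) (g : G) : ‖((f g : ℂˣ) : ℂ)‖ = 1 := by
  -- adapted from `ContinuousMonoidHom.norm_apply_eq_one` (GaloisRepresentations/PadicCharacterCyclotomicFactorProofs)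
  obtain ⟨M, hM⟩ : ∃ M : ℝ, ∀ τ : G, ‖((f τ : ℂˣ) : ℂ)‖ ≤ M := by
    obtain ⟨M, hM⟩ := (isCompact_range (continuous_norm.comp hf)).isBounded.bddAbove
    exact ⟨M, fun τ => hM ⟨τ, rfl⟩⟩
  have hle : ∀ τ : G, ‖((f τ : ℂˣ) : ℂ)‖ ≤ 1 := by
    intro τ
    by_contra h
    rw [not_le] at h
    obtain ⟨n, hn⟩ := ((tendsto_pow_atTop_atTop_of_one_lt h).eventually_gt_atTop M).exists
    have : ‖((f τ : ℂˣ) : ℂ)‖ ^ n ≤ M := by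
      rw [← norm_pow, ← Units.val_pow_eq_pow_val, ← map_pow]
      exact hM _
    exact (lt_irrefl M) (hn.trans_le this)
  refine le_antisymm (hle g) ?_
  have h1 := hle g⁻¹
  rw [map_inv, Units.val_inv_eq_inv_val, norm_inv] at h1
  have hpos : 0 < ‖((f g : ℂˣ) : ℂ)‖ := norm_pos_iff.mpr (f g).ne_zero
  rwa [inv_le_one₀ hpos] at h1

/-! ## §1 The junction datum of a twisted representation -/

variable {F : Type} (E : Type) [Field F] [NumberField F] [Field E] [NumberField E] [Algebra F E]
  [Algebra.IsQuadraticExtension F E] (v : HeightOneSpectrum (𝓞 F)) (c : E ≃ₐ[F] E) (N : ℕ)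
  (J : Matrix (Fin N) (Fin N) E) {δ : E} (hcδ : c δ = -δ) (hδ : δ ≠ 0) (hN : 2 ≤ N) (hJh : (J.map c)ᵀ = J)
  (hJdet : J.det ≠ 0) (J₁ : Matrix (Fin 1) (Fin 1) E) (hJ₁ : J₁ 0 0 ≠ 0)

section Eta

variable (η : localPi E c N J v →* ℂˣ)

omit [Algebra.IsQuadraticExtension F E] in
/-- **an open-kernel character of `U(J)(F_v)` is continuous on the centre `U(J₁)(F_v)`** (`η ∘ localCenter` has open
kernel by `continuous_localCenter`, hence is locally constant). [cite: BernsteinZelevinsky1976, §2.1] -/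
theorem continuous_eta_localCenter (hker : IsOpen ((η.ker : Subgroup (localPi E c N J v)) : Set (localPi E c N J v))) :
    Continuous fun h : localPi E c 1 J₁ v => ((η (localCenter E c N J J₁ hJ₁ v h) : ℂˣ) : ℂ) := by
  have hθ : IsOpen (((η.comp (localCenter E c N J J₁ hJ₁ v)).ker : Subgroup (localPi E c 1 J₁ v)) :
      Set (localPi E c 1 J₁ v)) := by
    rw [← MonoidHom.comap_ker, Subgroup.coe_comap]
    exact hker.preimage (continuous_localCenter E c N J J₁ hJ₁ v)
  exact continuous_coe_of_isOpen_ker _ hθ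

/-- **at a NON-SPLIT place an open-kernel character of `U(J)(F_v)` is unitary on the centre** (`U(J₁)(F_v) = E_v¹` is
compact there, `compactSpace_localPi_one_of_smul_eq`). [cite: PlatonovRapinchuk1994, §6.2] -/
theorem norm_eta_localCenter_eq_one (hc1 : c ≠ 1) (w : UnitaryGroup.PlacesOver E v) (hw : c • w.1 = w.1)
    (hker : IsOpen ((η.ker : Subgroup (localPi E c N J v)) : Set (localPi E c N J v))) (h : localPi E c 1 J₁ v) :
    ‖((η (localCenter E c N J J₁ hJ₁ v h) : ℂˣ) : ℂ)‖ = 1 := by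
  haveI : CompactSpace (localPi E c 1 J₁ v) := compactSpace_localPi_one_of_smul_eq c J₁ hc1 hJ₁ w hw
  exact norm_coe_eq_one_of_compactSpace (η.comp (localCenter E c N J J₁ hJ₁ v))
    (continuous_eta_localCenter E v c N J J₁ hJ₁ η hker) h

variable (χ : localPi E c 1 J₁ v →* ℂˣ) (hχn : ∀ h, ‖((χ h : ℂˣ) : ℂ)‖ = 1)
  (hχc : Continuous fun h => ((χ h : ℂˣ) : ℂ))
  (hηn : ∀ h : localPi E c 1 J₁ v, ‖((η (localCenter E c N J J₁ hJ₁ v h) : ℂˣ) : ℂ)‖ = 1)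
  (hηc : Continuous fun h : localPi E c 1 J₁ v => ((η (localCenter E c N J J₁ hJ₁ v h) : ℂˣ) : ℂ))

omit [Algebra.IsQuadraticExtension F E] in
include hχn hηn in
/-- the twisted Step-3 character `χ · (η ∘ centre)` is unitary. [cite: Liu2021, App. D §D.1 Step 3 (l. 5221)] -/
theorem norm_mul_eta_localCenter (h : localPi E c 1 J₁ v) :
    ‖(((χ * η.comp (localCenter E c N J J₁ hJ₁ v)) h : ℂˣ) : ℂ)‖ = 1 := by
  rw [MonoidHom.mul_apply, MonoidHom.comp_apply, Units.val_mul, norm_mul, hχn h, hηn h, mul_one]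

omit [Algebra.IsQuadraticExtension F E] in
include hχc hηc in
/-- the twisted Step-3 character `χ · (η ∘ centre)` is continuous. [cite: Liu2021, App. D §D.1 Step 3 (l. 5221)] -/
theorem continuous_mul_eta_localCenter :
    Continuous fun h : localPi E c 1 J₁ v => (((χ * η.comp (localCenter E c N J J₁ hJ₁ v)) h : ℂˣ) : ℂ) := by
  have hf : (fun h : localPi E c 1 J₁ v => (((χ * η.comp (localCenter E c N J J₁ hJ₁ v)) h : ℂˣ) : ℂ)) =
      fun h => ((χ h : ℂˣ) : ℂ) * ((η (localCenter E c N J J₁ hJ₁ v h) : ℂˣ) : ℂ) := by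
    funext h
    rw [MonoidHom.mul_apply, MonoidHom.comp_apply, Units.val_mul]
  rw [hf]
  exact hχc.mul hηc

include hηn in
/-- `η ∘ uEquiv` is unitary on the scalar centre `S.scalar (E_v¹)` of the standing data (the two centres agree,
`localCenter_theta`). [cite: Liu2021, App. D §D.1 Step 3 (l. 5221)] -/
theorem norm_eta_uEquiv_scalar (z : (standingData E v c N J hcδ hδ hN hJh hJdet).normOne) :
    ‖(((η.comp (uEquiv E v c N J hcδ hδ hN hJh hJdet).toMulEquiv.toMonoidHom)
        ((standingData E v c N J hcδ hδ hN hJh hJdet).scalar z) : ℂˣ) : ℂ)‖ = 1 := by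
  have h := hηn (theta E v c N J hcδ hδ hN hJh hJdet J₁ z)
  rw [localCenter_theta E v c N J hcδ hδ hN hJh hJdet J₁ hJ₁] at h
  exact h

include hJ₁ hηc in
/-- `η ∘ uEquiv` is continuous on the scalar centre (it is `(η ∘ localCenter) ∘ θ`, `θ` continuous).
[cite: Liu2021, App. D §D.1 Step 3 (l. 5221)] -/
theorem continuous_eta_uEquiv_scalar :
    Continuous fun z : (standingData E v c N J hcδ hδ hN hJh hJdet).normOne =>
      ((((η.comp (uEquiv E v c N J hcδ hδ hN hJh hJdet).toMulEquiv.toMonoidHom)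
        ((standingData E v c N J hcδ hδ hN hJh hJdet).scalar z) : ℂˣ) : ℂ)) := by
  have hf : (fun z : (standingData E v c N J hcδ hδ hN hJh hJdet).normOne =>
      ((((η.comp (uEquiv E v c N J hcδ hδ hN hJh hJdet).toMulEquiv.toMonoidHom)
        ((standingData E v c N J hcδ hδ hN hJh hJdet).scalar z) : ℂˣ) : ℂ))) =
      (fun h : localPi E c 1 J₁ v => ((η (localCenter E c N J J₁ hJ₁ v h) : ℂˣ) : ℂ)) ∘
        theta E v c N J hcδ hδ hN hJh hJdet J₁ := by
    funext z
    rw [Function.comp_apply, localCenter_theta E v c N J hcδ hδ hN hJh hJdet J₁ hJ₁]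
    rfl
  rw [hf]
  exact hηc.comp (continuous_theta E v c N J hcδ hδ hN hJh hJdet J₁)

variable {V : Type} [AddCommGroup V] [Module ℂ V] (ω : Representation ℂ (localPi E c N J v) V)
  (μ : (LocalRing E v)ˣ →* ℂˣ) (hμn : ∀ x, ‖((μ x : ℂˣ) : ℂ)‖ = 1) (hμc : Continuous fun x => ((μ x : ℂˣ) : ℂ))
  (hμF : ∀ a : (v.adicCompletion F)ˣ,
    μ (Units.map (algebraMap (v.adicCompletion F) (LocalRing E v)).toMonoidHom a) = 1 ↔
      ∃ x : (LocalRing E v)ˣ, (x : LocalRing E v) * conjLocal E c v x =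
        algebraMap (v.adicCompletion F) (LocalRing E v) a)

/-- **Twisting the junction datum is the junction datum of the twisted representation**: the `LemD1Data.twist` of
`data ω μ χ` by `η ∘ uEquiv` is `data (η • ω) μ (χ · η∘centre)` — same standing data, `ε`, `μ`; carrier
`(η • ω) ∘ uEquiv = (η ∘ uEquiv) • (ω ∘ uEquiv)`; Step-3 character `(χ · η∘localCenter) ∘ θ = χ∘θ · (η∘uEquiv)∘scalar`
by `localCenter_theta`. [cite: Liu2021, App. D §D.1 Steps 1–3 (l. 5215–5222)] [cite: GelbartRogawski1991, §3.1 Remark p. 457 L4–13] -/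
theorem data_twist_eq :
    (data E v c N J hcδ hδ hN hJh hJdet J₁ ω μ hμn hμc hμF χ hχn hχc).twist
        (η.comp (uEquiv E v c N J hcδ hδ hN hJh hJdet).toMulEquiv.toMonoidHom)
        (norm_eta_uEquiv_scalar E v c N J hcδ hδ hN hJh hJdet J₁ hJ₁ η hηn)
        (continuous_eta_uEquiv_scalar E v c N J hcδ hδ hN hJh hJdet J₁ hJ₁ η hηc) =
      data E v c N J hcδ hδ hN hJh hJdet J₁ (SeesawScalar.twist η ω) μ hμn hμc hμF
        (χ * η.comp (localCenter E c N J J₁ hJ₁ v))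
        (norm_mul_eta_localCenter E v c N J J₁ hJ₁ η χ hχn hηn)
        (continuous_mul_eta_localCenter E v c N J J₁ hJ₁ η χ hχc hηc) := by
  have hchi : χ.comp (theta E v c N J hcδ hδ hN hJh hJdet J₁) *
        (η.comp (uEquiv E v c N J hcδ hδ hN hJh hJdet).toMulEquiv.toMonoidHom).comp
          (standingData E v c N J hcδ hδ hN hJh hJdet).scalar =
      (χ * η.comp (localCenter E c N J J₁ hJ₁ v)).comp (theta E v c N J hcδ hδ hN hJh hJdet J₁) := by
    refine MonoidHom.ext fun z => ?_
    simp only [MonoidHom.mul_apply, MonoidHom.comp_apply]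
    rw [localCenter_theta E v c N J hcδ hδ hN hJh hJdet J₁ hJ₁]
    rfl
  unfold LemD1Data.twist data
  congr 1

end Eta

/-! ## §2 Lemma D.1 (first sentence + (1)) AS PRINTED at the junction datum is invariant under open-kernel twists
unitary on the centre, rank `N ≠ 2` -/

section TwistIff

variable (η : localPi E c N J v →* ℂˣ)
  (χ : localPi E c 1 J₁ v →* ℂˣ) (hχn : ∀ h, ‖((χ h : ℂˣ) : ℂ)‖ = 1) (hχc : Continuous fun h => ((χ h : ℂˣ) : ℂ))
  (hηn : ∀ h : localPi E c 1 J₁ v, ‖((η (localCenter E c N J J₁ hJ₁ v h) : ℂˣ) : ℂ)‖ = 1)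
  {V : Type} [AddCommGroup V] [Module ℂ V] (ω : Representation ℂ (localPi E c N J v) V)
  (μ : (LocalRing E v)ˣ →* ℂˣ) (hμn : ∀ x, ‖((μ x : ℂˣ) : ℂ)‖ = 1) (hμc : Continuous fun x => ((μ x : ℂˣ) : ℂ))
  (hμF : ∀ a : (v.adicCompletion F)ˣ,
    μ (Units.map (algebraMap (v.adicCompletion F) (LocalRing E v)).toMonoidHom a) = 1 ↔
      ∃ x : (LocalRing E v)ˣ, (x : LocalRing E v) * conjLocal E c v x =
        algebraMap (v.adicCompletion F) (LocalRing E v) a)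

/-- the kernel of `η ∘ uEquiv` is open when that of `η` is (`uEquiv` is a homeomorphism). [folklore] -/
private theorem isOpen_ker_comp_uEquiv (hker : IsOpen ((η.ker : Subgroup (localPi E c N J v)) : Set (localPi E c N J v))) :
    IsOpen ((((η.comp (uEquiv E v c N J hcδ hδ hN hJh hJdet).toMulEquiv.toMonoidHom).ker :
      Subgroup (standingData E v c N J hcδ hδ hN hJh hJdet).U) : Set (standingData E v c N J hcδ hδ hN hJh hJdet).U)) := by
  rw [← MonoidHom.comap_ker, Subgroup.coe_comap]
  exact hker.preimage (uEquiv E v c N J hcδ hδ hN hJh hJdet).continuous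

/-- **[Liu2021, App. D Lem. D.1, first sentence + (1)] AS PRINTED at the junction datum does not see an open-kernel
twist of `ω` unitary on the centre, rank `N ≠ 2`**:
`LemD1_1AsPrinted (data (η • ω) μ (χ · η∘centre)) ↔ LemD1_1AsPrinted (data ω μ χ)` — `data_twist_eq` +
`LemD1_1AsPrinted.twist_iff`. [cite: Liu2021, App. D Lemma D.1 (l. 5227–5229)] [cite: GelbartRogawski1991, §3.1 Remark p. 457 L4–13] -/
theorem lemD1_1AsPrinted_data_twist_iff (hN2 : N ≠ 2)
    (hker : IsOpen ((η.ker : Subgroup (localPi E c N J v)) : Set (localPi E c N J v))) :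
    LemD1_1AsPrinted (data E v c N J hcδ hδ hN hJh hJdet J₁ (SeesawScalar.twist η ω) μ hμn hμc hμF
        (χ * η.comp (localCenter E c N J J₁ hJ₁ v))
        (norm_mul_eta_localCenter E v c N J J₁ hJ₁ η χ hχn hηn)
        (continuous_mul_eta_localCenter E v c N J J₁ hJ₁ η χ hχc
          (continuous_eta_localCenter E v c N J J₁ hJ₁ η hker))) ↔
      LemD1_1AsPrinted (data E v c N J hcδ hδ hN hJh hJdet J₁ ω μ hμn hμc hμF χ hχn hχc) := by
  rw [← data_twist_eq E v c N J hcδ hδ hN hJh hJdet J₁ hJ₁ η χ hχn hχc hηn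
    (continuous_eta_localCenter E v c N J J₁ hJ₁ η hker) ω μ hμn hμc hμF]
  exact LemD1_1AsPrinted.twist_iff _ _ _ _ (isOpen_ker_comp_uEquiv E v c N J hcδ hδ hN hJh hJdet η hker) hN2

include hJ₁ hηn in
/-- **the family of readings over ALL Step-3 characters passes to a twist**: if Lemma D.1 (first sentence + (1)) AS
PRINTED holds at `data ω μ χ` for every unitary continuous character `χ` of the centre `U(J₁)(F_v)`, then it holds at
`data (η • ω) μ χ` for every such `χ` (apply the previous theorem to `χ · (η∘centre)⁻¹`), `N ≠ 2`, `ker η` open, `η`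
unitary on the centre. [cite: Liu2021, App. D Lemma D.1 (l. 5227–5229)] -/
theorem forall_lemD1_1AsPrinted_of_twist (hN2 : N ≠ 2)
    (hker : IsOpen ((η.ker : Subgroup (localPi E c N J v)) : Set (localPi E c N J v)))
    (H : ∀ (χ : localPi E c 1 J₁ v →* ℂˣ) (hχn : ∀ h, ‖((χ h : ℂˣ) : ℂ)‖ = 1)
      (hχc : Continuous fun h => ((χ h : ℂˣ) : ℂ)),
      LemD1_1AsPrinted (data E v c N J hcδ hδ hN hJh hJdet J₁ ω μ hμn hμc hμF χ hχn hχc))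
    (χ : localPi E c 1 J₁ v →* ℂˣ) (hχn : ∀ h, ‖((χ h : ℂˣ) : ℂ)‖ = 1)
    (hχc : Continuous fun h => ((χ h : ℂˣ) : ℂ)) :
    LemD1_1AsPrinted (data E v c N J hcδ hδ hN hJh hJdet J₁ (SeesawScalar.twist η ω) μ hμn hμc hμF χ hχn hχc) := by
  have hηc := continuous_eta_localCenter E v c N J J₁ hJ₁ η hker
  -- `χ₀ := χ · (η∘centre)⁻¹`, unitary and continuous
  set χ₀ : localPi E c 1 J₁ v →* ℂˣ := χ * (η.comp (localCenter E c N J J₁ hJ₁ v))⁻¹ with hχ₀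
  have hχ₀n : ∀ h, ‖((χ₀ h : ℂˣ) : ℂ)‖ = 1 := fun h => by
    rw [hχ₀, MonoidHom.mul_apply, MonoidHom.inv_apply, MonoidHom.comp_apply, Units.val_mul, norm_mul,
      Units.val_inv_eq_inv_val, norm_inv, hχn h, hηn h, inv_one, mul_one]
  have hχ₀c : Continuous fun h => ((χ₀ h : ℂˣ) : ℂ) := by
    have hf : (fun h => ((χ₀ h : ℂˣ) : ℂ)) =
        fun h => ((χ h : ℂˣ) : ℂ) * (((η (localCenter E c N J J₁ hJ₁ v h) : ℂˣ) : ℂ))⁻¹ := by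
      funext h
      rw [hχ₀, MonoidHom.mul_apply, MonoidHom.inv_apply, MonoidHom.comp_apply, Units.val_mul, Units.val_inv_eq_inv_val]
    rw [hf]
    exact hχc.mul (hηc.inv₀ fun h => Units.ne_zero _)
  have key := (lemD1_1AsPrinted_data_twist_iff E v c N J hcδ hδ hN hJh hJdet J₁ hJ₁ η χ₀ hχ₀n hχ₀c hηn ω μ hμn hμc
    hμF hN2 hker).2 (H χ₀ hχ₀n hχ₀c)
  have e : χ₀ * η.comp (localCenter E c N J J₁ hJ₁ v) = χ := by
    refine MonoidHom.ext fun h => ?_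
    rw [hχ₀, MonoidHom.mul_apply, MonoidHom.mul_apply, MonoidHom.inv_apply, inv_mul_cancel_right]
  -- transport along `χ₀ · (η∘centre) = χ` (the remaining arguments are proofs)
  have gen : ∀ (χ' : localPi E c 1 J₁ v →* ℂˣ) (p : ∀ h, ‖((χ' h : ℂˣ) : ℂ)‖ = 1)
      (q : Continuous fun h => ((χ' h : ℂˣ) : ℂ)), χ' = χ →
      (LemD1_1AsPrinted (data E v c N J hcδ hδ hN hJh hJdet J₁ (SeesawScalar.twist η ω) μ hμn hμc hμF χ' p q) ↔
        LemD1_1AsPrinted (data E v c N J hcδ hδ hN hJh hJdet J₁ (SeesawScalar.twist η ω) μ hμn hμc hμF χ hχn hχc)) := by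
    rintro χ' p q rfl
    rfl
  exact (gen _ _ _ e).1 key

end TwistIff

/-! ## §3 At a non-split place: the reading for all Step-3 characters does not depend on the local splittings -/

section Nonsplit

variable {d : F} {hd : δ * δ = algebraMap F E d} {T : Matrix (Fin N) (Fin N) F} {hT : T.IsSymm}
  {hJ : J = T.map (algebraMap F E)}
  (μ : (LocalRing E v)ˣ →* ℂˣ) (hμn : ∀ x, ‖((μ x : ℂˣ) : ℂ)‖ = 1) (hμc : Continuous fun x => ((μ x : ℂˣ) : ℂ))
  (hμF : ∀ a : (v.adicCompletion F)ˣ,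
    μ (Units.map (algebraMap (v.adicCompletion F) (LocalRing E v)).toMonoidHom a) = 1 ↔
      ∃ x : (LocalRing E v)ˣ, (x : LocalRing E v) * conjLocal E c v x =
        algebraMap (v.adicCompletion F) (LocalRing E v) a)

include hJ₁

/-- one direction of `forall_lemD1_1AsPrinted_iff_of_nonsplit`, for an ordered pair of families. [cite: Liu2021, App. D Lemma D.1 (l. 5227–5229)] -/
private theorem forall_lemD1_1AsPrinted_of_nonsplit (hc1 : c ≠ 1) (w : UnitaryGroup.PlacesOver E v)
    (hw : c • w.1 = w.1) (hN2 : N ≠ 2) (hTd : IsUnit T.det) (𝓢 𝓢' : FinLocalSplittings F E c N hcδ hδ hd T hT hJ)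
    (H : ∀ (χ : localPi E c 1 J₁ v →* ℂˣ) (hχn : ∀ h, ‖((χ h : ℂˣ) : ℂ)‖ = 1)
      (hχc : Continuous fun h => ((χ h : ℂˣ) : ℂ)),
      LemD1_1AsPrinted (data E v c N J hcδ hδ hN hJh hJdet J₁ (𝓢.omegaLoc v) μ hμn hμc hμF χ hχn hχc))
    (χ : localPi E c 1 J₁ v →* ℂˣ) (hχn : ∀ h, ‖((χ h : ℂˣ) : ℂ)‖ = 1)
    (hχc : Continuous fun h => ((χ h : ℂˣ) : ℂ)) :
    LemD1_1AsPrinted (data E v c N J hcδ hδ hN hJh hJdet J₁ (𝓢'.omegaLoc v) μ hμn hμc hμF χ hχn hχc) := by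
  obtain ⟨η, hker, hη⟩ := 𝓢.exists_twist_omegaLoc hTd 𝓢' v
  have hηn := norm_eta_localCenter_eq_one E v c N J J₁ hJ₁ η hc1 w hw hker
  rw [hη]
  exact forall_lemD1_1AsPrinted_of_twist E v c N J hcδ hδ hN hJh hJdet J₁ hJ₁ η hηn (𝓢.omegaLoc v) μ hμn hμc hμF hN2
    hker H χ hχn hχc

/-- **At a NON-SPLIT place the reading of [Liu2021, App. D Lem. D.1, first sentence + (1)] AS PRINTED for ALL Step-3
characters does not depend on the choice of local splittings** (rank `N ≠ 2`): for two restricted families `𝓢, 𝓢'`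
of local splittings of `U(J)(F_v)` into `S̃p_{ψ_v}(𝕎_v)` (`J = T ⊗ 1`, `det T ≠ 0`) and `v` non-split in `E/F`
(`c • w = w` for the place `w ∣ v`, `c ≠ 1`),
`(∀ χ, LemD1_1AsPrinted (data (𝓢.omegaLoc v) μ χ)) ↔ (∀ χ, LemD1_1AsPrinted (data (𝓢'.omegaLoc v) μ χ))`,
`χ` ranging over the unitary continuous characters of the centre `U(J₁)(F_v) = E_v¹`.  Ingredients: the two local Weil
representations differ by an open-kernel character (`FinLocalSplittings.exists_twist_omegaLoc`, [GelbartRogawski1991,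
§3.1 Remark p. 457]), unitary on the compact centre (`norm_eta_localCenter_eq_one`), and §2.
[cite: Liu2021, App. D Lemma D.1 (l. 5227–5229)] [cite: GelbartRogawski1991, §3.1 Remark p. 457 L4–13] -/
theorem forall_lemD1_1AsPrinted_iff_of_nonsplit (hc1 : c ≠ 1) (w : UnitaryGroup.PlacesOver E v)
    (hw : c • w.1 = w.1) (hN2 : N ≠ 2) (hTd : IsUnit T.det) (𝓢 𝓢' : FinLocalSplittings F E c N hcδ hδ hd T hT hJ) :
    (∀ (χ : localPi E c 1 J₁ v →* ℂˣ) (hχn : ∀ h, ‖((χ h : ℂˣ) : ℂ)‖ = 1)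
        (hχc : Continuous fun h => ((χ h : ℂˣ) : ℂ)),
        LemD1_1AsPrinted (data E v c N J hcδ hδ hN hJh hJdet J₁ (𝓢.omegaLoc v) μ hμn hμc hμF χ hχn hχc)) ↔
      (∀ (χ : localPi E c 1 J₁ v →* ℂˣ) (hχn : ∀ h, ‖((χ h : ℂˣ) : ℂ)‖ = 1)
        (hχc : Continuous fun h => ((χ h : ℂˣ) : ℂ)),
        LemD1_1AsPrinted (data E v c N J hcδ hδ hN hJh hJdet J₁ (𝓢'.omegaLoc v) μ hμn hμc hμF χ hχn hχc)) :=
  ⟨forall_lemD1_1AsPrinted_of_nonsplit E v c N J hcδ hδ hN hJh hJdet J₁ hJ₁ μ hμn hμc hμF hc1 w hw hN2 hTd 𝓢 𝓢',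
    forall_lemD1_1AsPrinted_of_nonsplit E v c N J hcδ hδ hN hJh hJdet J₁ hJ₁ μ hμn hμc hμF hc1 w hw hN2 hTd 𝓢' 𝓢⟩

end Nonsplit

end Literature.NumberTheory.Automorphic.Liu2021.LemD1OfPlace

end
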